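import Summits.Ventures.PercRepro.S1CellBounds
import Summits.Ventures.PercRepro.S1Ladder
import Summits.Ventures.PercRepro.S1Lever

/-!
# PercRepro — A CELL BY THE COLOOP LADDER: THE GENERIC CASE (p2, gen 21; SUBCLAIM-S1 §6.5)

A core `M` of rank `p + c` with EXACTLY `c` coloops and `p + c + d` points: the exact ladder (S1Ladder) gives the
coloop-free sub-core `N` of rank `p` on `p + d` points with `#U_M = #U_N` and `#Y_N + A ≤ #Y_M + B`
(`A = Σ_{j<c} 2^{n−1−j}`, `B = Σ_{j<c} W₃⁺(n − 1 − j)`); `N` takes the lever caps (S1Lever) at its own point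
count; the cell form's two bounds (S1CellBounds) turn `Φ(p + c, 4)·#U_N + B ≤ #Y_N + A` into the kernel
condition `ladderOK`. `c = 0` is the coloop-free cell itself.

* `ladderOK` — the kernel condition; `weighted_of_ladderOK` — its meaning on a capped core;
* **`rls_of_ladder_case`** — `RLS` at `(p + c, 4)` for a core with exactly `c` coloops from one kernel evaluation;
* `rls_of_ladder_case_cap` — the same with the four-circuit cap supplied by hand (for p7's series-class cap).
Axioms: standard.
-/

open scoped Matroid

namespace PercRepro

namespace S1

open Set

variable {α : Type}

/-- **The kernel condition of a ladder case**: with the cell `(p, d)`'s numbers and the credit `A − B` on the `Y`-side,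
`Φ(p0, 4)·U⁺ + B ≤ Y⁻ + A` in integers (`phiNum(p0)·UB + phiDen(p0)·(R34 + 7560·B) ≤ phiDen(p0)·(Ysum + 7560·A)`). -/
def ladderOK (p0 p d P S S5 A B : ℕ) : Bool :=
  decide ((2 ^ (p0 + 4) - 2 * ∑ u ∈ Finset.range 5, CoreRegimes.chooseF (p0 + 4) u) * cellUB p d P S S5 +
    CoreRegimes.chooseF (p0 + 4) 4 * (cellR34 p d P S S5 + 7560 * B) ≤
    CoreRegimes.chooseF (p0 + 4) 4 * (cellYsum p d + 7560 * A))

/-- **What `ladderOK` means**: on the capped core `N` of rank `p`, `Φ(p0, 4)·#U_N(p, 4) + B ≤ #Y_N(p, 4) + A`. -/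
theorem weighted_of_ladderOK (N : Matroid α) [N.Finite] (p0 p d P S S5 A B : ℕ) (hd4 : 4 ≤ d)
    (hR : N.eRank = (p : ℕ∞)) (hn : N.E.ncard = p + d)
    (hfree : ∀ e ∈ N.E, ∃ X ⊆ N.E \ {e}, e ∉ N.closure X ∧ e ∉ N.closure ((N.E \ {e}) \ X))
    (hP : {C : Set α | N.IsCircuit C ∧ C.ncard = 3}.ncard ≤ P) (hS : {C : Set α | N.IsCircuit C ∧ C.ncard = 4}.ncard ≤ S)
    (hS5 : {C : Set α | N.IsCircuit C ∧ C.ncard = 5}.ncard ≤ S5)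
    (hp : 5 ≤ p) (hp0 : 5 ≤ p0) (hok : ladderOK p0 p d P S S5 A B = true) :
    phiK p0 4 * (Matroid.topCount N p 4 : ℚ) + B ≤ (Matroid.midCount N p 4 : ℚ) + A := by
  obtain ⟨hUB, hYB⟩ := cell_bounds N p d P S S5 hd4 hR hn hfree hP hS hS5 hp
  unfold ladderOK at hok
  simp only [CoreRegimes.chooseF_eq] at hok
  have hok' := of_decide_eq_true hok
  set phiNum := 2 ^ (p0 + 4) - 2 * ∑ u ∈ Finset.range 5, (p0 + 4).choose u with hphiNum
  set phiDen := (p0 + 4).choose 4 with hphiDen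
  set UB := cellUB p d P S S5
  set R34 := cellR34 p d P S S5
  set Ysum := cellYsum p d
  set T := Matroid.topCount N p 4
  set Y := Matroid.midCount N p 4
  -- the `ℕ` chain
  have h1 : phiNum * (7560 * T) ≤ phiNum * UB := Nat.mul_le_mul_left _ hUB
  have h2 : phiDen * Ysum ≤ phiDen * (7560 * Y + R34) := Nat.mul_le_mul_left _ hYB
  have hchain : phiNum * (7560 * T) + phiDen * (7560 * B) ≤ phiDen * (7560 * Y) + phiDen * (7560 * A) := by
    have e1 : phiDen * (R34 + 7560 * B) = phiDen * R34 + phiDen * (7560 * B) := by ring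
    have e2 : phiDen * (Ysum + 7560 * A) = phiDen * Ysum + phiDen * (7560 * A) := by ring
    have e3 : phiDen * (7560 * Y + R34) = phiDen * (7560 * Y) + phiDen * R34 := by ring
    rw [e1, e2] at hok'
    rw [e3] at h2
    omega
  -- to `ℚ`
  have hsum : 2 * ∑ u ∈ Finset.range 5, (p0 + 4).choose u ≤ 2 ^ (p0 + 4) := by
    have := sum_Ioo_choose_add_four p0 hp0
    omega
  have hphiNumQ : (phiNum : ℚ) = 2 ^ (p0 + 4) - 2 * ∑ u ∈ Finset.range 5, ((p0 + 4).choose u : ℚ) := by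
    rw [hphiNum, Nat.cast_sub hsum]
    push_cast
    ring
  have hΦ := phiK_four_mul_choose_eq p0 hp0
  rw [← hphiNumQ] at hΦ
  have hDenPos : (0 : ℚ) < (phiDen : ℚ) := by
    rw [hphiDen]; exact_mod_cast Nat.choose_pos (by omega)
  have hchainQ : (phiNum : ℚ) * (7560 * (T : ℚ)) + (phiDen : ℚ) * (7560 * (B : ℚ)) ≤
      (phiDen : ℚ) * (7560 * (Y : ℚ)) + (phiDen : ℚ) * (7560 * (A : ℚ)) := by
    have h : ((phiNum * (7560 * T) + phiDen * (7560 * B) : ℕ) : ℚ) ≤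
        ((phiDen * (7560 * Y) + phiDen * (7560 * A) : ℕ) : ℚ) := by exact_mod_cast hchain
    push_cast at h
    linarith
  have hkey : (phiK p0 4 * (T : ℚ) + (B : ℚ)) * (phiDen : ℚ) ≤ ((Y : ℚ) + (A : ℚ)) * (phiDen : ℚ) := by
    have e : (phiK p0 4 * (T : ℚ) + (B : ℚ)) * (phiDen : ℚ) =
        (phiK p0 4 * (phiDen : ℚ)) * (T : ℚ) + (phiDen : ℚ) * (B : ℚ) := by ring
    rw [e, hphiDen, hΦ, ← hphiDen]
    nlinarith [hchainQ]
  exact le_of_mul_le_mul_right hkey hDenPos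

/-- **ONE LADDER CASE**: a finite `e`-free core of rank `p0 = p + c` (`p ≥ 5`) on `n = p0 + d` points (`d ≥ 4`) with
EXACTLY `c` coloops satisfies `RLS` at `(p0, 4)` once the lever caps `P, S, S5` of its coloop-free part (rank `p`,
`p + d` points, nullity `d`) pass the kernel condition with the ladder's credit. -/
theorem rls_of_ladder_case (M : Matroid α) [M.Finite] {p0 p c d n : ℕ} (hp0 : p0 = p + c) (hnd : n = p0 + d)
    (hR : M.eRank = (p0 : ℕ∞)) (hn : M.E.ncard = n)
    (hfree : ∀ e ∈ M.E, ∃ A ⊆ M.E \ {e}, e ∉ M.closure A ∧ e ∉ M.closure ((M.E \ {e}) \ A))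
    (hc : M.coloops.ncard = c) (hp : 5 ≤ p) (hd4 : 4 ≤ d) {P S S5 : ℕ}
    (hP : min ((p + d) * TriangleCap.cq3 (d - 1) / (p + d - 3)) (TriangleCap.cq3 d) ≤ P)
    (hS : (p + d) * ThmN.avgChain16 (d - 1) / (p + d - 4) ≤ S)
    (hS5 : (p + d) * avgChain5b (d - 1) / (p + d - 5) ≤ S5)
    (hok : ladderOK p0 p d P S S5 (∑ j ∈ Finset.range c, 2 ^ (n - 1 - j))
      (∑ j ∈ Finset.range c, w3plus (n - 1 - j)) = true) :
    ThmN.RLS M p0 4 := by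
  subst hp0
  have hR' : M.eRank = ((p + c : ℕ) : ℕ∞) := hR
  obtain ⟨N, hNfin, hNR, hNn, hNcol, hNfree, hNtop, hNmid⟩ := ladder_exact c M p hR' (by omega) (by omega) hfree
  have hNn' : N.E.ncard = p + d := by omega
  have hNcol0 : N.coloops = ∅ := by
    have h0 : N.coloops.ncard = 0 := by omega
    exact (Set.ncard_eq_zero (N.ground_finite.subset N.coloops_subset_ground)).1 h0
  have hNd : N.E.encard = N.eRank + ((d - 1 + 1 : ℕ) : ℕ∞) := by
    rw [hNR, ← N.ground_finite.cast_ncard_eq, hNn', show d - 1 + 1 = d by omega]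
    push_cast
    ring
  have hNd' : N.E.encard = N.eRank + (((d - 1 : ℕ) : ℕ∞) + 1) := by rw [hNd, Nat.cast_succ]
  have hNdd : N.E.encard = N.eRank + ((d : ℕ) : ℕ∞) := by rw [hNd, show d - 1 + 1 = d by omega]
  have hP' : {C : Set α | N.IsCircuit C ∧ C.ncard = 3}.ncard ≤ P :=
    (le_min (ncard_triangles_le_of_coloopFree N hNfree hNd hNcol0 hNn' (by omega))
      (TriangleCap.core_ncard_triangles_le_cq3 N hNfree hNdd)).trans hP
  have hS' := (ncard_fourCircuits_le_of_coloopFree N hNfree hNd' hNcol0 hNn' (by omega)).trans hS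
  have hS5' := (ncard_fiveCircuits_le_of_coloopFree N hNfree hNd' hNcol0 hNn' (by omega)).trans hS5
  have hw := weighted_of_ladderOK N (p + c) p d P S S5 _ _ hd4 hNR hNn' hNfree hP' hS' hS5' hp (by omega) hok
  rw [ThmN.RLS_iff, hNtop]
  rw [hn] at hNmid
  have hmidQ : ((Matroid.midCount N p 4 : ℕ) : ℚ) + ((∑ j ∈ Finset.range c, 2 ^ (n - 1 - j) : ℕ) : ℚ) ≤
      ((Matroid.midCount M (p + c) 4 : ℕ) : ℚ) + ((∑ j ∈ Finset.range c, w3plus (n - 1 - j) : ℕ) : ℚ) := by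
    exact_mod_cast hNmid
  linarith

/-- **ONE LADDER CASE WITH THE FOUR-CIRCUIT CAP SUPPLIED**: as `rls_of_ladder_case`, with `s₄ ≤ S` on the
coloop-free part given directly (for p7's series-class cap at nullity `7`). -/
theorem rls_of_ladder_case_cap (M : Matroid α) [M.Finite] {p0 p c d n : ℕ} (hp0 : p0 = p + c) (hnd : n = p0 + d)
    (hR : M.eRank = (p0 : ℕ∞)) (hn : M.E.ncard = n)
    (hfree : ∀ e ∈ M.E, ∃ A ⊆ M.E \ {e}, e ∉ M.closure A ∧ e ∉ M.closure ((M.E \ {e}) \ A))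
    (hc : M.coloops.ncard = c) (hp : 5 ≤ p) (hd4 : 4 ≤ d) {P S S5 : ℕ}
    (hP : min ((p + d) * TriangleCap.cq3 (d - 1) / (p + d - 3)) (TriangleCap.cq3 d) ≤ P)
    (hScap : ∀ (N : Matroid α) [N.Finite],
      (∀ e ∈ N.E, ∃ A ⊆ N.E \ {e}, e ∉ N.closure A ∧ e ∉ N.closure ((N.E \ {e}) \ A)) →
      N.E.encard = N.eRank + ((d : ℕ) : ℕ∞) → N.E.ncard = p + d → N.coloops = ∅ →
      {C : Set α | N.IsCircuit C ∧ C.ncard = 4}.ncard ≤ S)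
    (hS5 : (p + d) * avgChain5b (d - 1) / (p + d - 5) ≤ S5)
    (hok : ladderOK p0 p d P S S5 (∑ j ∈ Finset.range c, 2 ^ (n - 1 - j))
      (∑ j ∈ Finset.range c, w3plus (n - 1 - j)) = true) :
    ThmN.RLS M p0 4 := by
  subst hp0
  have hR' : M.eRank = ((p + c : ℕ) : ℕ∞) := hR
  obtain ⟨N, hNfin, hNR, hNn, hNcol, hNfree, hNtop, hNmid⟩ := ladder_exact c M p hR' (by omega) (by omega) hfree
  have hNn' : N.E.ncard = p + d := by omega
  have hNcol0 : N.coloops = ∅ := by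
    have h0 : N.coloops.ncard = 0 := by omega
    exact (Set.ncard_eq_zero (N.ground_finite.subset N.coloops_subset_ground)).1 h0
  have hNd : N.E.encard = N.eRank + ((d - 1 + 1 : ℕ) : ℕ∞) := by
    rw [hNR, ← N.ground_finite.cast_ncard_eq, hNn', show d - 1 + 1 = d by omega]
    push_cast
    ring
  have hNd' : N.E.encard = N.eRank + (((d - 1 : ℕ) : ℕ∞) + 1) := by rw [hNd, Nat.cast_succ]
  have hNdd : N.E.encard = N.eRank + ((d : ℕ) : ℕ∞) := by rw [hNd, show d - 1 + 1 = d by omega]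
  have hP' : {C : Set α | N.IsCircuit C ∧ C.ncard = 3}.ncard ≤ P :=
    (le_min (ncard_triangles_le_of_coloopFree N hNfree hNd hNcol0 hNn' (by omega))
      (TriangleCap.core_ncard_triangles_le_cq3 N hNfree hNdd)).trans hP
  have hS' := hScap N hNfree hNdd hNn' hNcol0
  have hS5' := (ncard_fiveCircuits_le_of_coloopFree N hNfree hNd' hNcol0 hNn' (by omega)).trans hS5
  have hw := weighted_of_ladderOK N (p + c) p d P S S5 _ _ hd4 hNR hNn' hNfree hP' hS' hS5' hp (by omega) hok
  rw [ThmN.RLS_iff, hNtop]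
  rw [hn] at hNmid
  have hmidQ : ((Matroid.midCount N p 4 : ℕ) : ℚ) + ((∑ j ∈ Finset.range c, 2 ^ (n - 1 - j) : ℕ) : ℚ) ≤
      ((Matroid.midCount M (p + c) 4 : ℕ) : ℚ) + ((∑ j ∈ Finset.range c, w3plus (n - 1 - j) : ℕ) : ℚ) := by
    exact_mod_cast hNmid
  linarith

end S1

end PercRepro
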